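import Mathlib.Algebra.BigOperators.Ring.Finset
import Mathlib.Algebra.BigOperators.Fin
import Mathlib.Algebra.Order.BigOperators.Ring.Finset
import Mathlib.Data.Real.Basic
import Mathlib.Data.Fintype.Perm
import Mathlib.Tactic.FieldSimp
import Mathlib.Tactic.Ring
import Mathlib.Tactic.Positivity
import HarnessLib

/-!
# Finite probability spaces and expectations (Dupuy–Hilado, *The statement of Mochizuki's
# Corollary 3.12*, §2.2) — the averaging layer of Mochizuki's "log-volumes"

Dupuy–Hilado, arXiv:2004.13228 (pre-split text; published version Ramanujan J. **68** (2025)),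
§2.2 "Finite Probability Spaces", read on the page (corpus render `paper:arxiv-2004.13228`, chunk 6):

> "By a finite probability space we mean a pair `(S, Pr_S)` where `S` is a finite set and
> `Pr_S : S → [0,1]` is a function satisfying `Σ_{s∈S} Pr_S(s) = 1`. … If `f(x)` is a vector valued
> function on `S` we define the expectation to be `𝔼(f(x) : x ∈ S) := Σ_{s∈S} f(s) Pr(s)`. … Given
> two such space `(S₁, Pr₁)` and `(S₂, Pr₂)` we form the independent product `(S₁ × S₂, Pr₁ × Pr₂)`
> by declaring `Pr(s₁, s₂) = Pr(s₁) Pr(s₂)`."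

Why this elementary layer is a file of its own: Dupuy–Hilado §1 p. 4 "the "log-volumes" in [IUT3]
and [IUT4] are not actually logarithms of volumes but rather averages of weighted sums of logs of
normalized `p`-adic and archimedean Haar measures. To streamline the presentation we have found it
convenient to think probabilistically". Every normalisation in [IUTchIII] Prop. 3.9 / [IUTchIV]
Prop. 1.4 ("procession-normalized", "packet-normalized") and in Dupuy–Hilado §3.5–§3.6, Thm. 3.10.1
is an expectation over one of three finite probability spaces: the places of `F₀` over `p` with
`Pr(v) = [F_{0,v}:ℚ_p]/[F₀:ℚ]`, its `(j+1)`-fold independent power (tensor packets), and the uniform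
space on the procession indices `j = 1, …, (l−1)/2` (lgp-degree, Def. 3.1.1). This file supplies
exactly the bookkeeping those uses need: linearity, constants, monotonicity, the independent product
and power with their marginal ("Fubini") identities, invariance of the power under permutation of the
coordinates (used for (Ind1), Dupuy–Hilado §4.7), and the uniform space.

Design: UNBUNDLED weights on a `Fintype` (`ProbWeights S`), real-valued (all uses are real
averages); Mathlib's `PMF` (`ℝ≥0∞`-valued, `tsum`) is deliberately not used — every space here is
finite and every identity is a `Finset.sum` manipulation. Deliberately NOT here: any measure theory,
any number theory (see `ArakelovDivisors`, `FakeAdeleIndex` in this directory).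
-/

namespace Literature.IUT.LogVolume

open Finset

/-- A finite probability space in the sense of Dupuy–Hilado §2.2: weights `Pr : S → [0,1]` on a
finite set `S` with `Σ_s Pr(s) = 1` (non-negativity + total mass one; `Pr(s) ≤ 1` follows).
[cite: DupuyHilado2025, §2.2] -/
structure ProbWeights (S : Type*) [Fintype S] where
  /-- the probability function `Pr_S` -/
  pr : S → ℝ
  /-- `Pr(s) ≥ 0` -/
  pr_nonneg : ∀ s, 0 ≤ pr s
  /-- `Σ_{s∈S} Pr(s) = 1` -/
  sum_pr : ∑ s, pr s = 1

namespace ProbWeights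

variable {S T : Type*} [Fintype S] [Fintype T] (P : ProbWeights S) (Q : ProbWeights T)

/-- The expectation `𝔼(f(x) : x ∈ S) := Σ_{s∈S} f(s) Pr(s)` (real-valued `f`).
[cite: DupuyHilado2025, §2.2] -/
def expect (f : S → ℝ) : ℝ := ∑ s, f s * P.pr s

/-- `Pr(s) ≤ 1`. [cite: DupuyHilado2025, §2.2] -/
theorem pr_le_one (s : S) : P.pr s ≤ 1 := by
  calc P.pr s = ∑ t ∈ {s}, P.pr t := by simp
    _ ≤ ∑ t, P.pr t := Finset.sum_le_sum_of_subset_of_nonneg (by simp) fun t _ _ => P.pr_nonneg t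
    _ = 1 := P.sum_pr

/-- A probability space is non-empty (total mass one). [cite: DupuyHilado2025, §2.2] -/
theorem nonempty (P : ProbWeights S) : Nonempty S := by
  rcases isEmpty_or_nonempty S with h | h
  · exact absurd P.sum_pr (by simp)
  · exact h

/-- `𝔼(c) = c`. [cite: DupuyHilado2025, §2.2] -/
theorem expect_const (c : ℝ) : P.expect (fun _ => c) = c := by
  simp [expect, ← Finset.mul_sum, P.sum_pr]

/-- `𝔼(f + g) = 𝔼(f) + 𝔼(g)`. [cite: DupuyHilado2025, §2.2] -/
theorem expect_add (f g : S → ℝ) : P.expect (fun s => f s + g s) = P.expect f + P.expect g := by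
  simp [expect, add_mul, Finset.sum_add_distrib]

/-- `𝔼(f − g) = 𝔼(f) − 𝔼(g)`. [cite: DupuyHilado2025, §2.2] -/
theorem expect_sub (f g : S → ℝ) : P.expect (fun s => f s - g s) = P.expect f - P.expect g := by
  simp [expect, sub_mul, Finset.sum_sub_distrib]

/-- `𝔼(−f) = −𝔼(f)`. [cite: DupuyHilado2025, §2.2] -/
theorem expect_neg (f : S → ℝ) : P.expect (fun s => -f s) = -P.expect f := by
  simp [expect, Finset.sum_neg_distrib]

/-- `𝔼(c·f) = c·𝔼(f)`. [cite: DupuyHilado2025, §2.2] -/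
theorem expect_const_mul (c : ℝ) (f : S → ℝ) : P.expect (fun s => c * f s) = c * P.expect f := by
  simp [expect, Finset.mul_sum, mul_assoc]

/-- `𝔼(Σ_i f_i) = Σ_i 𝔼(f_i)` for a finite family. [cite: DupuyHilado2025, §2.2] -/
theorem expect_finset_sum {ι : Type*} (I : Finset ι) (f : ι → S → ℝ) :
    P.expect (fun s => ∑ i ∈ I, f i s) = ∑ i ∈ I, P.expect (f i) := by
  simp only [expect, Finset.sum_mul]
  rw [Finset.sum_comm]

/-- Monotonicity: `f ≤ g ⟹ 𝔼(f) ≤ 𝔼(g)`. [cite: DupuyHilado2025, §2.2] -/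
theorem expect_mono {f g : S → ℝ} (h : ∀ s, f s ≤ g s) : P.expect f ≤ P.expect g :=
  Finset.sum_le_sum fun s _ => mul_le_mul_of_nonneg_right (h s) (P.pr_nonneg s)

/-- If `f = g` on the support of `Pr` then `𝔼(f) = 𝔼(g)`. [cite: DupuyHilado2025, §2.2] -/
theorem expect_congr_support {f g : S → ℝ} (h : ∀ s, P.pr s ≠ 0 → f s = g s) :
    P.expect f = P.expect g := by
  refine Finset.sum_congr rfl fun s _ => ?_
  by_cases hs : P.pr s = 0
  · simp [hs]
  · rw [h s hs]

/-- An expectation of a function bounded by `c` is bounded by `c`. [cite: DupuyHilado2025, §2.2] -/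
theorem expect_le_of_le {f : S → ℝ} {c : ℝ} (h : ∀ s, f s ≤ c) : P.expect f ≤ c := by
  calc P.expect f ≤ P.expect (fun _ => c) := P.expect_mono h
    _ = c := P.expect_const c

/-! ### Independent product -/

/-- The independent product `(S₁ × S₂, Pr₁ × Pr₂)`, `Pr(s₁, s₂) = Pr(s₁) Pr(s₂)`.
[cite: DupuyHilado2025, §2.2] -/
def prod : ProbWeights (S × T) where
  pr x := P.pr x.1 * Q.pr x.2
  pr_nonneg x := mul_nonneg (P.pr_nonneg _) (Q.pr_nonneg _)
  sum_pr := by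
    rw [Fintype.sum_prod_type, ← Finset.sum_mul_sum, P.sum_pr, Q.sum_pr, one_mul]

/-- Weights of the product. [cite: DupuyHilado2025, §2.2] -/
theorem prod_pr (x : S × T) : (P.prod Q).pr x = P.pr x.1 * Q.pr x.2 := rfl

/-- Marginal in the first factor: `𝔼_{S×T}(f(s)) = 𝔼_S(f)`. [cite: DupuyHilado2025, §2.2] -/
theorem expect_prod_fst (f : S → ℝ) : (P.prod Q).expect (fun x => f x.1) = P.expect f := by
  simp only [expect, prod_pr, Fintype.sum_prod_type]
  refine Finset.sum_congr rfl fun s _ => ?_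
  rw [← Finset.mul_sum, ← Finset.mul_sum, Q.sum_pr, mul_one]

/-- Marginal in the second factor: `𝔼_{S×T}(g(t)) = 𝔼_T(g)`. [cite: DupuyHilado2025, §2.2] -/
theorem expect_prod_snd (g : T → ℝ) : (P.prod Q).expect (fun x => g x.2) = Q.expect g := by
  simp only [expect, prod_pr, Fintype.sum_prod_type_right]
  refine Finset.sum_congr rfl fun t _ => ?_
  have h : ∀ s, g t * (P.pr s * Q.pr t) = (g t * Q.pr t) * P.pr s := fun s => by ring
  simp_rw [h]
  rw [← Finset.mul_sum, P.sum_pr, mul_one]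

/-- Iterated expectation: `𝔼_{S×T}(h) = 𝔼_S(𝔼_T(h(s, ·)))`. [cite: DupuyHilado2025, §2.2] -/
theorem expect_prod (h : S × T → ℝ) :
    (P.prod Q).expect h = P.expect (fun s => Q.expect (fun t => h (s, t))) := by
  simp only [expect, prod_pr, Fintype.sum_prod_type, Finset.sum_mul]
  refine Finset.sum_congr rfl fun s _ => Finset.sum_congr rfl fun t _ => ?_
  ring

/-! ### Independent power `S^n` (tuples) -/

/-- The `n`-fold independent power on `n`-tuples `S^n = (Fin n → S)`, `Pr(e) = Π_i Pr(e_i)` —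
Dupuy–Hilado §3.6: "Since products of probability spaces are probability spaces the sets
`V(F₀)_p^{r+1}` also have the natural structure of a probability space."
[cite: DupuyHilado2025, §2.2, §3.6] -/
def pi (n : ℕ) : ProbWeights (Fin n → S) where
  pr e := ∏ i, P.pr (e i)
  pr_nonneg e := Finset.prod_nonneg fun i _ => P.pr_nonneg (e i)
  sum_pr := by rw [← Fintype.sum_pow (f := P.pr) n, P.sum_pr, one_pow]

/-- Weights of the power. [cite: DupuyHilado2025, §2.2, §3.6] -/
theorem pi_pr (n : ℕ) (e : Fin n → S) : (P.pi n).pr e = ∏ i, P.pr (e i) := rfl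

/-- Marginal of the power in one coordinate: `𝔼_{S^{m+1}}(f(e_i)) = 𝔼_S(f)` — the step
"`𝔼(ln|t_{v_{r−1}}|_p : (v_0,…,v_{r−1}) ∈ V(F₀)_p^r) = 𝔼(ln|t_v|_p : v ∈ V(F₀)_p)`" in the proof
of Dupuy–Hilado Thm. 3.10.1. [cite: DupuyHilado2025, §2.2, Thm. 3.10.1 proof] -/
theorem expect_pi_coord (m : ℕ) (i : Fin (m + 1)) (f : S → ℝ) :
    (P.pi (m + 1)).expect (fun e => f (e i)) = P.expect f := by
  classical
  simp only [expect, pi_pr]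
  -- separate the `i`-th coordinate: `S^{m+1} ≃ S × S^m`
  rw [← Fintype.sum_equiv (Fin.insertNthEquiv (fun _ => S) i)
    (fun p : S × (Fin m → S) => f p.1 * (P.pr p.1 * ∏ j, P.pr (p.2 j)))
    (fun e : Fin (m + 1) → S => f (e i) * ∏ j, P.pr (e j))]
  · rw [Fintype.sum_prod_type]
    refine Finset.sum_congr rfl fun a _ => ?_
    simp only
    rw [← Finset.mul_sum, ← Finset.mul_sum, ← Fintype.sum_pow (f := P.pr) m, P.sum_pr, one_pow,
      mul_one]
  · intro p
    simp only [Fin.insertNthEquiv_apply, Fin.insertNth_apply_same]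
    rw [Fin.prod_univ_succAbove _ i, Fin.insertNth_apply_same]
    simp only [Fin.insertNth_apply_succAbove]

/-- The power is invariant under permuting the coordinates: `Pr(e ∘ σ) = Pr(e)`.
[cite: DupuyHilado2025, §2.2, §4.7] -/
theorem pi_pr_comp_perm (n : ℕ) (σ : Equiv.Perm (Fin n)) (e : Fin n → S) :
    (P.pi n).pr (e ∘ σ) = (P.pi n).pr e := by
  simp only [pi_pr, Function.comp_apply]
  exact Equiv.prod_comp σ (fun i => P.pr (e i))

/-- Hence expectations over `S^n` are invariant under reindexing the tuples by a permutation: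
`𝔼(g(e ∘ σ)) = 𝔼(g(e))` — the averaging half of "(Ind1) preserves log-volumes" (Dupuy–Hilado §4.7:
(Ind1) acts on `⊕_{(v_0,…,v_j)} K_{v_0} ⊗ ⋯ ⊗ K_{v_j}` by permuting tensor factors, i.e. by
permuting the coordinates of the index tuples). [cite: DupuyHilado2025, §2.2, §4.7] -/
theorem expect_pi_comp_perm (n : ℕ) (σ : Equiv.Perm (Fin n)) (g : (Fin n → S) → ℝ) :
    (P.pi n).expect (fun e => g (e ∘ σ)) = (P.pi n).expect g := by
  simp only [expect]
  -- reindex the sum along the bijection `e ↦ e ∘ σ` of `S^n`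
  have hbij : Function.Bijective (fun e : Fin n → S => e ∘ σ) :=
    (Equiv.arrowCongr σ (Equiv.refl S)).symm.bijective
  rw [← Function.Bijective.sum_comp hbij (fun e => g e * (P.pi n).pr e)]
  refine Finset.sum_congr rfl fun e _ => ?_
  rw [P.pi_pr_comp_perm]

/-! ### The uniform space -/

/-- The uniform probability space on a non-empty finite set: `Pr(s) = 1/|S|` — Dupuy–Hilado
Def. 3.1.1: the lgp-degree "is simply the uniform average of the degrees of its components … =
`𝔼(deĝ_L(P_j) : 1 ≤ j ≤ r)`". [cite: DupuyHilado2025, §2.2, Def. 3.1.1] -/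
noncomputable def uniform (S : Type*) [Fintype S] [Nonempty S] : ProbWeights S where
  pr _ := 1 / (Fintype.card S : ℝ)
  pr_nonneg _ := by positivity
  sum_pr := by
    have : (Fintype.card S : ℝ) ≠ 0 := by exact_mod_cast Fintype.card_ne_zero
    simp only [Finset.sum_const, Finset.card_univ, nsmul_eq_mul]
    field_simp

/-- `𝔼_uniform(f) = (1/|S|) Σ_s f(s)`. [cite: DupuyHilado2025, §2.2, Def. 3.1.1] -/
theorem expect_uniform (S : Type*) [Fintype S] [Nonempty S] (f : S → ℝ) :
    (uniform S).expect f = (1 / (Fintype.card S : ℝ)) * ∑ s, f s := by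
  simp only [expect, uniform]
  rw [← Finset.sum_mul, mul_comm]

/-- On `Fin r` (`r ≥ 1`): `𝔼(f(j) : j ∈ Fin r) = (1/r) Σ_{j<r} f(j)` — the shape of the lgp-degree
`(1/r) Σ_{j=1}^r deĝ(P_j)` once `j ↦ j+1` re-indexes `Fin r` to `{1,…,r}`.
[cite: DupuyHilado2025, Def. 3.1.1] -/
theorem expect_uniform_fin (r : ℕ) [NeZero r] (f : ℕ → ℝ) :
    (uniform (Fin r)).expect (fun j => f (j + 1)) = (1 / (r : ℝ)) * ∑ j ∈ range r, f (j + 1) := by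
  rw [expect_uniform, Fintype.card_fin, Fin.sum_univ_eq_sum_range (fun j => f (j + 1)) r]

end ProbWeights

end Literature.IUT.LogVolume
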